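import Summits.HodgeConjecture.HodgeConjecture.Theses.HeckePrymWeil
import Summits.HodgeConjecture.HodgeConjecture.Theorems.HeckePrymWeilWeilDescendingUpward
import Summits.HodgeConjecture.HodgeConjecture.Theorems.HeckePrymWeilProductDescentTransfer
import Literature.AlgebraicGeometry.Motives.AbelianVarietyProduct
import Literature.AlgebraicGeometry.Motives.AbelianVarietyProductDimProofs
import Literature.AlgebraicGeometry.Motives.ComplexPointsOrientation
import Literature.AlgebraicGeometry.HodgeTheory.WeilClassesFourfoldsProofs
import Literature.AlgebraicGeometry.HodgeTheory.AlgebraicClassesCupAbelianVariety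
import HarnessLib

/-!
# Crux `WeilTenfoldsSqrtMinus11` (stmt-HodgeConjecture-1262), line `generic-ppav-secant-descent` — stub `stub_descent`

Schoen's descent `12 → 10` for ONE partner surface (C. Schoen, *Addendum to: Hodge classes on
self-products of a variety with an automorphism*, Compositio Math. 114 (1998), §10, Proposition and
proof; E. Markman, arXiv:2509.23403 §11.5 Step 2), the registered stub S6 of the line's skeleton,
PROVED UNCONDITIONALLY on the tree's real carriers (no Gysin formalism, no named fact is assumed).

Statement. Let `(A, φ)` be a complex abelian tenfold and `(B, φ_B)` a complex abelian surface with
`φ² = -11`, `φ_B² = -11`; suppose `B` carries a descent pair — eigenclasses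
`b₊ ∈ Eig((𝟙+φ_B)^*, (1+i√11)²)`, `b₋ ∈ Eig((𝟙+φ_B)^*, (1-i√11)²)` with `b₊ + b₋` rational of type
`(1,1)`, and an algebraic class `η ∈ N¹H²(B(ℂ); ℂ)` with `b₊ ⌣ η ≠ 0`, `b₋ ⌣ η ≠ 0` — and put
`ψ = φ × φ_B` on `A × B`. GIVEN Künneth for Hodge types on products of abelian varieties (the
statement of the line's stub `stub_hodgeTypeExterior`, the first hypothesis): IF every rational
`(6,6)`-class of the Weil span `Eig((𝟙+ψ)^*, (1+i√11)¹²) ⊔ Eig((𝟙+ψ)^*, (1-i√11)¹²)` of `A × B` is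
algebraic, THEN every rational `(5,5)`-class `c = c₊ + c₋` of the Weil span of `(A, φ)` is algebraic.

Proof (Schoen §10, component-free; every ingredient is a THEOREM of the tree):
* `P = pr_A^* c ⌣ pr_B^*(b₊ + b₋)` is rational and, by the Künneth hypothesis at
  `(a, b) = (10, 2)`, `(p, q) = (5, 5)`, `(p', q') = (1, 1)`, of Hodge type `(6,6)` on `A × B`;
* the rational Weil projector (`weilEigencomponents_mem_algebraicClasses_of_rung`, route file
  `Theorems/HeckePrymWeilWeilDescendingUpward`, at `p = 11`, `n = 5`): with `T = (𝟙 + ψ)^*` the four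
  pieces of `P` are `T`-eigenvectors for `λ₊¹²`, `λ₋¹²`, `λ₊¹⁰λ₋²`, `λ₊²λ₋¹⁰` (`λ± = 1 ± i√11`);
  `Q = q(T)P`, `q(X) = (X - λ₊¹⁰λ₋²)(X - λ₊²λ₋¹⁰) ∈ ℤ[X]`, and `TQ` are rational `(6,6)` classes of the
  Weil span of `A × B`, hence algebraic by the twelvefold hypothesis, and the `2 × 2` inversion
  (`λ₊ᵏ ≠ λ₋ᵏ`, Niven) returns `P₊₊ = pr_A^* c₊ ⌣ pr_B^* b₊` and `P₋₋` algebraic;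
* `P±± ⌣ pr_B^* η` is algebraic (flat pull-back of the divisor class `η`,
  `map_snd_mem_supportedClasses`; cup with a divisor class on an abelian variety, moving by
  translations, `AbelianVariety.cupProduct_mem_algebraicClasses_one`);
* Schoen's transfer along the tree's REAL Gysin morphism `complexGysin μ` of `pr_A`
  (`mem_algebraicClasses_of_complexGysin_fst_cupProduct`, route file
  `Theorems/HeckePrymWeilProductDescentTransfer`; Poincaré duality, Borel–Moore base change and
  Künneth spanning are theorems of the tree): `pr_{A*}(P±± ⌣ pr_B^* η) = ε± • c±` is algebraic, with
  `ε± • 1 = pr_{A*} pr_B^*(b± ⌣ η) ≠ 0` because `b± ⌣ η ≠ 0` is a non-zero top class of `B`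
  (`complexGysin_fst_map_snd_ne_zero`); hence `c±`, and `c = c₊ + c₋`, are algebraic.
-/

noncomputable section

-- single-problem summit (Problem = Summit): the mandated namespace repeats `HodgeConjecture`.
set_option linter.dupNamespace false

open CategoryTheory Complex
open Literature.AlgebraicGeometry Literature.AlgebraicGeometry.Motives
  Literature.AlgebraicGeometry.HodgeTheory Literature.AlgebraicTopology.SingularHomology

namespace Summit.HodgeConjecture.HodgeConjecture.Theorems.HeckePrymWeil

section Descent

/- The statement of the line's stub `stub_hodgeTypeExterior` (Künneth for Hodge types on a product
of complex abelian varieties), as a section hypothesis: the registered signature of `stub_descent`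
refers to it through `type_of% stub_hodgeTypeExterior`, i.e. takes this proposition as its first
hypothesis (the theorem below does NOT assume it otherwise: it is an explicit `→`-hypothesis). -/
variable (stub_hodgeTypeExterior :
  ∀ (A B : AbelianVariety ℂ) (a b : ℕ), A.dim = a → B.dim = b →
    ∀ (k l m : ℕ) (hklm : k + l = m) (p q p' q' : ℕ)
      (c : complexBetti A.X k) (w : complexBetti B.X l),
      IsOfHodgeType a A.X k p q c → IsOfHodgeType b B.X l p' q' w →
      IsOfHodgeType (a + b) (A.prod B).X m (p + p') (q + q')
        (cupProduct hklm (complexBetti.map (AbelianVariety.fst A B).hom.hom.hom k c)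
          (complexBetti.map (AbelianVariety.snd A B).hom.hom.hom l w)))

/-- **Stub 6 — Schoen's descent `12 → 10` for ONE partner surface, GIVEN Künneth for Hodge types
(the statement of Stub 5).** Let `(A, φ)` be a complex abelian tenfold and `(B, φ_B)` a complex
abelian surface, `φ² = φ_B² = -11`, `B` carrying a descent pair `(b₊, b₋, η)` (eigenclasses of
`(𝟙+φ_B)^*` for `(1 ± i√11)²` with `b₊ + b₋` rational of type `(1,1)`, `η` algebraic,
`b± ⌣ η ≠ 0`), and `ψ = φ × φ_B` on `A × B`. IF every rational `(6,6)`-class in the Weil span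
`Eig((𝟙+ψ)^*, (1+i√11)¹²) ⊔ Eig((𝟙+ψ)^*, (1-i√11)¹²)` of `A × B` is algebraic, THEN every rational
`(5,5)`-class in the Weil span of `A` is algebraic (Schoen 1998 §10, Proposition and proof; Markman
arXiv:2509.23403 §11.5 Step 2): rational Weil projector on `A × B`, cup with the pulled-back
divisor class `η`, and the transfer `pr_{A*}` along the tree's real Gysin morphism, whose scalar
`pr_{A*} pr_B^*(b± ⌣ η)` is non-zero because `b± ⌣ η` is a non-zero top class of `B` (module
docstring). -/
theorem stub_descent :
    (type_of% stub_hodgeTypeExterior) →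
    ∀ (A : AbelianVariety ℂ) (φ : A ⟶ A) (B : AbelianVariety ℂ) (φB : B ⟶ B),
      A.dim = 10 → B.dim = 2 → φ ≫ φ = -((11 : ℤ) • 𝟙 A) → φB ≫ φB = -((11 : ℤ) • 𝟙 B) →
      (∃ bp bm η : complexBetti B.X 2,
        bp ∈ Module.End.eigenspace (complexBetti.map (𝟙 B + φB).hom.hom.hom 2).hom
              ((1 + Complex.I * (Real.sqrt (11 : ℝ) : ℂ)) ^ 2) ∧
        bm ∈ Module.End.eigenspace (complexBetti.map (𝟙 B + φB).hom.hom.hom 2).hom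
              ((1 - Complex.I * (Real.sqrt (11 : ℝ) : ℂ)) ^ 2) ∧
        IsRationalClass (bp + bm) ∧ IsOfHodgeType 2 B.X 2 1 1 (bp + bm) ∧
        η ∈ algebraicClasses B.X 1 ∧
        cupProduct (show 2 + 2 = 4 from rfl) bp η ≠ 0 ∧
        cupProduct (show 2 + 2 = 4 from rfl) bm η ≠ 0) →
      (∀ u : complexBetti (A.prod B).X 12, IsRationalClass u →
        IsOfHodgeType 12 (A.prod B).X 12 6 6 u →
        u ∈ Module.End.eigenspace (complexBetti.map (𝟙 (A.prod B) +
                AbelianVariety.prodLift (AbelianVariety.fst A B ≫ φ)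
                  (AbelianVariety.snd A B ≫ φB)).hom.hom.hom 12).hom
              ((1 + Complex.I * (Real.sqrt (11 : ℝ) : ℂ)) ^ 12) ⊔
            Module.End.eigenspace (complexBetti.map (𝟙 (A.prod B) +
                AbelianVariety.prodLift (AbelianVariety.fst A B ≫ φ)
                  (AbelianVariety.snd A B ≫ φB)).hom.hom.hom 12).hom
              ((1 - Complex.I * (Real.sqrt (11 : ℝ) : ℂ)) ^ 12) →
        u ∈ algebraicClasses (A.prod B).X 6) →
      ∀ c : complexBetti A.X 10, IsRationalClass c → IsOfHodgeType 10 A.X 10 5 5 c →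
        c ∈ Module.End.eigenspace (complexBetti.map (𝟙 A + φ).hom.hom.hom 10).hom
              ((1 + Complex.I * (Real.sqrt (11 : ℝ) : ℂ)) ^ 10) ⊔
            Module.End.eigenspace (complexBetti.map (𝟙 A + φ).hom.hom.hom 10).hom
              ((1 - Complex.I * (Real.sqrt (11 : ℝ) : ℂ)) ^ 10) →
        c ∈ algebraicClasses A.X 5 := by
  intro hE A φ B φB hAdim hBdim _hφ _hφB hpair halgAB c hc hcH hcW
  obtain ⟨bp, bm, η, hbp, hbm, hbr, hbH, hη, hpt, hmt⟩ := hpair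
  -- smoothness witnesses and the orientation family
  have hA : Motives.IsSmoothProjective (2 * 5) A.X := isSmoothProjective_of_dim_eq hAdim
  have hB : Motives.IsSmoothProjective (2 * 1) B.X := isSmoothProjective_of_dim_eq hBdim
  have hAB : Motives.IsSmoothProjective (2 * (5 + 1)) (A.prod B).X :=
    isSmoothProjective_prod_two_mul hA hB
  let μ : OrientationFamily := fun _ _ h ↦ Classical.choice (Motives.ComplexPoints.isOrientableOver ℂ h)
  -- `c = c₊ + c₋`, and the eigen-equations
  obtain ⟨cp, hcp, cm, hcm, rfl⟩ := Submodule.mem_sup.1 hcW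
  rw [Module.End.mem_eigenspace_iff] at hcp hcm hbp hbm
  -- the compatible endomorphism `ψ = φ × φ_B`
  set Φ : A.prod B ⟶ A.prod B := AbelianVariety.prodLift (AbelianVariety.fst A B ≫ φ)
    (AbelianVariety.snd A B ≫ φB) with hΦ
  have h₁ : Φ ≫ AbelianVariety.fst A B = AbelianVariety.fst A B ≫ φ :=
    AbelianVariety.prodLift_fst _ _
  have h₂ : Φ ≫ AbelianVariety.snd A B = AbelianVariety.snd A B ≫ φB :=
    AbelianVariety.prodLift_snd _ _
  -- Hodge type `(6,6)` of `P = pr_A^* c ⌣ pr_B^*(b₊ + b₋)` (the Künneth hypothesis)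
  have h : 2 * 5 + 2 * 1 = 2 * (5 + 1) := rfl
  have hH : IsOfHodgeType (2 * (5 + 1)) (A.prod B).X (2 * (5 + 1)) (5 + 1) (5 + 1)
      (cupProduct h (complexBetti.map (AbelianVariety.fst A B).hom.hom.hom (2 * 5) (cp + cm))
        (complexBetti.map (AbelianVariety.snd A B).hom.hom.hom (2 * 1) (bp + bm))) :=
    hE A B (2 * 5) (2 * 1) hAdim hBdim (2 * 5) (2 * 1) (2 * (5 + 1)) h 5 5 1 1 (cp + cm) (bp + bm)
      hcH hbH
  -- the twelvefold hypothesis in the typing of the rung lemma (`p = 11`, `n = 5`)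
  have halgAB' : ∀ u : complexBetti (A.prod B).X (2 * (5 + 1)), IsRationalClass u →
      IsOfHodgeType (2 * (5 + 1)) (A.prod B).X (2 * (5 + 1)) (5 + 1) (5 + 1) u →
        u ∈ Module.End.eigenspace (complexBetti.map (𝟙 (A.prod B) + Φ).hom.hom.hom (2 * (5 + 1))).hom
              ((1 + Complex.I * (Real.sqrt ((11 : ℕ) : ℝ) : ℂ)) ^ (2 * (5 + 1))) ⊔
            Module.End.eigenspace (complexBetti.map (𝟙 (A.prod B) + Φ).hom.hom.hom (2 * (5 + 1))).hom
              ((1 - Complex.I * (Real.sqrt ((11 : ℕ) : ℝ) : ℂ)) ^ (2 * (5 + 1))) →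
          u ∈ algebraicClasses (A.prod B).X (5 + 1) := by
    have e11 : ((11 : ℕ) : ℝ) = (11 : ℝ) := by norm_num
    rw [e11]
    exact halgAB
  have hcp' : complexBetti.map (𝟙 A + φ).hom.hom.hom (2 * 5) cp =
      (1 + Complex.I * (Real.sqrt ((11 : ℕ) : ℝ) : ℂ)) ^ (2 * 5) • cp := by
    have e11 : ((11 : ℕ) : ℝ) = (11 : ℝ) := by norm_num
    rw [e11]
    exact hcp
  have hcm' : complexBetti.map (𝟙 A + φ).hom.hom.hom (2 * 5) cm =
      (1 - Complex.I * (Real.sqrt ((11 : ℕ) : ℝ) : ℂ)) ^ (2 * 5) • cm := by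
    have e11 : ((11 : ℕ) : ℝ) = (11 : ℝ) := by norm_num
    rw [e11]
    exact hcm
  have hbp' : complexBetti.map (𝟙 B + φB).hom.hom.hom (2 * 1) bp =
      (1 + Complex.I * (Real.sqrt ((11 : ℕ) : ℝ) : ℂ)) ^ (2 * 1) • bp := by
    have e11 : ((11 : ℕ) : ℝ) = (11 : ℝ) := by norm_num
    rw [e11]
    exact hbp
  have hbm' : complexBetti.map (𝟙 B + φB).hom.hom.hom (2 * 1) bm =
      (1 - Complex.I * (Real.sqrt ((11 : ℕ) : ℝ) : ℂ)) ^ (2 * 1) • bm := by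
    have e11 : ((11 : ℕ) : ℝ) = (11 : ℝ) := by norm_num
    rw [e11]
    exact hbm
  -- upward half (rational Weil projector): `pr_A^* c± ⌣ pr_B^* b±` are algebraic on `A × B`
  obtain ⟨hP, hMm⟩ := weilEigencomponents_mem_algebraicClasses_of_rung h₁ h₂ (p := 11) (n := 5)
    (by norm_num) (by norm_num) h hAB halgAB' hcp' hcm' hbp' hbm' hc hbr hH
  -- `pr_B^* η` is algebraic on `A × B`, hence so are `(pr_A^* c± ⌣ pr_B^* b±) ⌣ pr_B^* η`
  have hη' : complexBetti.map (AbelianVariety.snd A B).hom.hom.hom (2 * 1) η ∈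
      algebraicClasses (A.prod B).X 1 :=
    map_snd_mem_supportedClasses hA hB hη
  have halgp := AbelianVariety.cupProduct_mem_algebraicClasses_one (A.prod B) hP hη'
  have halgm := AbelianVariety.cupProduct_mem_algebraicClasses_one (A.prod B) hMm hη'
  -- the fibre integrals `pr_{A*} pr_B^*(b± ⌣ η) ≠ 0`
  have hjj' : 2 * 1 + 2 * 1 = 2 * (2 * 1) := rfl
  have hpt' : cupProduct hjj' bp η ≠ 0 := hpt
  have hmt' : cupProduct hjj' bm η ≠ 0 := hmt
  have hnep := complexGysin_fst_map_snd_ne_zero μ hA hB hpt'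
  have hnem := complexGysin_fst_map_snd_ne_zero μ hA hB hmt'
  -- Schoen's transfer, component by component
  refine Submodule.add_mem _ ?_ ?_
  · exact mem_algebraicClasses_of_complexGysin_fst_cupProduct μ hA hB (l := 5) (j := 2 * 1)
      (j' := 2 * 1) (s := 2 * (5 + 1)) h hjj' hnep halgp
  · exact mem_algebraicClasses_of_complexGysin_fst_cupProduct μ hA hB (l := 5) (j := 2 * 1)
      (j' := 2 * 1) (s := 2 * (5 + 1)) h hjj' hnem halgm

end Descent

end Summit.HodgeConjecture.HodgeConjecture.Theorems.HeckePrymWeil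

end
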